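import Summits.QuantumFields.YangMills.Theorems.SwapVirialDeficitSectorLaplaceBulkMassFloor
import Summits.QuantumFields.YangMills.Theorems.SwapVirialDeficitSectorLaplaceBulkFibredPlane
import Summits.QuantumFields.YangMills.Theorems.SwapVirialDeficitTwoSidedLogOfRelative
import Summits.QuantumFields.YangMills.Theorems.SwapVirialDeficitSectorLaplaceWindow
import HarnessLib

/-!
# (S)-road ➎, stub (S-bulk) part 2: THE TWO-SIDED LOG-LAPLACE LAW OF THE BULK REGION, per good sign pattern
# (free-hands support of ⟨stmt-QuantumFields-24197⟩ `SwapVirialDeficit.SwapGluedStiffness`; cell ym-idea-1, LEAD g98 memo6, assembler fcl-p3 g47)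

For a good sign pattern `ε`, a cut `0 < τ ≤ ½` and `Z_ε(t) = ∫_{HubBulk τ} I(a,ε;t) da`, `M_ε = ∫_{HubBulk τ}∫_{ℝ²}𝔪_ε` (`> 0`, part 1):

* §1 ★ `bulk_relative_law` — w2 g59's pointwise ✓`bulk_fibred_plane` (hypothesis form, constants `K, k`) integrated over `HubBulk τ` (✓`setIntegral_two_sided_of_pointwise`,
  S3-on-bulk ✓`integrableOn_integral_mbDensity_hubBulk`): `|Z_ε(t) − (2π∕t)^α M_ε| ≤ r(t)·((2π∕t)^α M_ε) + (∫ρ)·e^{−t(τ∕KL^k)^k}`, `r(t) = K L^k τ^{−k} t^{−1∕2}`;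
* §2 ★ `bulk_absorb` — the absolute term is `≤ t^{−1∕4}·(2π∕t)^α M_ε` once `t^{1∕4}(4(9L⁴+1) + Mfl(L)) ≤ t(τ∕KL^k)^k`, `Mfl(L) = |log cone(HubBulk ½)| + |log(coneConst³∕64)| +
  183620L⁸` (✓`exp_absorb`, ✓`bulkMass_exp_floor`, ✓`totalMass_le_exp`);
* §3 ★★ `bulk_logLaw` — with w2 ✓`twoSided_logLaw_of_relative`: `−α log t + C_ε − 2(r+x) ≤ log Z_ε(t) ≤ −α log t + C_ε + (r+x)`, `x = t^{−1∕4}`, `C_ε = α log 2π + log M_ε`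
  INDEPENDENT of `t` — the `hlow`∕`hup` of LEAD ✓`setStiffness_of_twoSided_logLaplace` (part 3).

HONEST LABEL: glue on landed inputs; the stub (S-bulk) itself is part 3; ⟨24197⟩ ∕ ⟨24194⟩ OPEN; ⟨24196⟩ proved elsewhere; item of record ⟨24085⟩ SubOctaveBounded aside ∕ untouched;
the Yang–Mills mass gap is NOT proved; no summit is proved by a line.  THEOREMS ONLY (0 `def`, 0 `sorry`), standard axioms; the `attribute [local instance]` block is the chart's
measurable structure on `ℍ` (as in ✓`SectorLaplaceDefs`; nothing overridden).  Seat ym-line-fcl-p3 g47 (cell ym-idea-1, free hands), `--supports stmt-QuantumFields-24197`.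
References: [cite: Luscher1983, §2]; [cite: Griffiths1964]; [folklore].
-/

set_option autoImplicit false
set_option synthInstance.maxSize 1024

noncomputable section

open MeasureTheory Quaternion Set
open scoped Quaternion BigOperators ENNReal
open Literature.MathematicalPhysics.QuantumLattice
open Literature.MathematicalPhysics.QuantumFieldTheory hiding SU2
open Summit.QuantumFields.YangMills.Theorems.SwapTwistDeficit.ToronLog

attribute [local instance] Literature.Analysis.FluidPDE.Tao2016.quatMeasurableSpace
  Literature.Analysis.FluidPDE.Tao2016.quatBorelSpace
  Literature.MathematicalPhysics.QuantumLattice.secondCountableTopology_su2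

namespace Summit.QuantumFields.YangMills.Theorems.SwapVirialDeficit.SectorLaplace

open Summit.QuantumFields.YangMills.Theorems.FemtoTransferGap
open Summit.QuantumFields.YangMills.Theorems.FemtoTransferGap.TT
open Summit.QuantumFields.YangMills.Theorems.VirialFluxGap.RingDeficit
open Summit.QuantumFields.YangMills.Theorems.SwapVirialDeficit.SwapRing
open Summit.QuantumFields.YangMills.Theorems.SwapVirialDeficit.BlowUpRing

variable {L : ℕ} [NeZero L]

/-! ## §1 The relative law on the bulk hubs -/

set_option maxHeartbeats 400000 in
/-- ★ **THE RELATIVE LAW ON `HubBulk τ`** from the pointwise plane law (hypothesis form of w2 g59's ✓`bulk_fibred_plane` with constants `K, k`) and S3-on-bulk: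
`|Z_ε(t) − (2π∕t)^α M_ε| ≤ r(t)·((2π∕t)^α M_ε) + (∫ρ)·e^{−t(τ∕KL^k)^k}`. [cite: Luscher1983, §2] -/
theorem bulk_relative_law {K : ℝ} {k : ℕ}
    (hS2 : ∀ (ψ₀ b : ℝ), 0 < ψ₀ → ψ₀ ≤ 1 → (K * (L : ℝ) ^ k * (1 / ψ₀) ^ k) ^ 2 ≤ b → ∀ a : ℍ, a ∈ HubBulk ψ₀ → ∀ ε : GnoSign L, GoodSign ε →
      |(∫ η : GnoCoord L, Real.exp (-(b * gnoDeficit z₀ (fun _ => 1) a ε η)) * gnoDensity η) - (2 * Real.pi / b) ^ alpha L * ∫ p : ℝ × ℝ, mbDensity a ε p| ≤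
        K * (L : ℝ) ^ k * (1 / ψ₀) ^ k * b ^ (-(1 / 2 : ℝ)) * ((2 * Real.pi / b) ^ alpha L * ∫ p : ℝ × ℝ, mbDensity a ε p) +
          (∫ η : GnoCoord L, gnoDensity η) * Real.exp (-(b * (ψ₀ / (K * (L : ℝ) ^ k)) ^ k)))
    {ε : GnoSign L} (hε : GoodSign ε) {τ : ℝ} (hτ : 0 < τ) (hτ1 : τ ≤ 1 / 2) {t : ℝ} (ht0 : 0 < t) (ht : (K * (L : ℝ) ^ k * (1 / τ) ^ k) ^ 2 ≤ t) :
    |(∫ a in HubBulk τ, hubIntegral a ε t ∂coneMeasure) - (2 * Real.pi / t) ^ alpha L * ∫ a in HubBulk τ, (∫ p : ℝ × ℝ, mbDensity (L := L) a ε p) ∂coneMeasure| ≤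
      K * (L : ℝ) ^ k * (1 / τ) ^ k * t ^ (-(1 / 2 : ℝ)) * ((2 * Real.pi / t) ^ alpha L * ∫ a in HubBulk τ, (∫ p : ℝ × ℝ, mbDensity (L := L) a ε p) ∂coneMeasure) +
        (∫ η : GnoCoord L, gnoDensity η) * Real.exp (-(t * (τ / (K * (L : ℝ) ^ k)) ^ k)) := by
  haveI := isProbabilityMeasure_coneMeasure
  have hS : MeasurableSet (HubBulk τ) := measurableSet_hubBulk τ
  have hSfin : coneMeasure (HubBulk τ) ≠ ⊤ := measure_ne_top _ _
  have hS1 : coneMeasure.real (HubBulk τ) ≤ 1 := by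
    have h := prob_le_one (μ := coneMeasure) (s := HubBulk τ)
    rw [measureReal_def]
    exact ENNReal.toReal_le_of_le_ofReal zero_le_one (by rwa [ENNReal.ofReal_one])
  have hM0 : 0 ≤ ∫ η : GnoCoord L, gnoDensity η := integral_nonneg fun η => (gnoDensity_pos η).le
  have hE0 : 0 ≤ Real.exp (-(t * (τ / (K * (L : ℝ) ^ k)) ^ k)) := (Real.exp_pos _).le
  have hpt : ∀ a ∈ HubBulk τ, |hubIntegral a ε t - (2 * Real.pi / t) ^ alpha L * ∫ p : ℝ × ℝ, mbDensity (L := L) a ε p| ≤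
      K * (L : ℝ) ^ k * (1 / τ) ^ k * t ^ (-(1 / 2 : ℝ)) * ((2 * Real.pi / t) ^ alpha L * ∫ p : ℝ × ℝ, mbDensity (L := L) a ε p) +
        (∫ η : GnoCoord L, gnoDensity η) * Real.exp (-(t * (τ / (K * (L : ℝ) ^ k)) ^ k)) :=
    fun a ha => hS2 τ t hτ (by linarith) ht a ha ε hε
  have h := setIntegral_two_sided_of_pointwise hS hSfin (integrable_hubIntegral ht0.le ε).integrableOn
    (integrableOn_integral_mbDensity_hubBulk (L := L) hε hτ (by linarith)) hpt
  refine h.trans (add_le_add le_rfl ?_)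
  calc (∫ η : GnoCoord L, gnoDensity η) * Real.exp (-(t * (τ / (K * (L : ℝ) ^ k)) ^ k)) * coneMeasure.real (HubBulk τ)
      ≤ (∫ η : GnoCoord L, gnoDensity η) * Real.exp (-(t * (τ / (K * (L : ℝ) ^ k)) ^ k)) * 1 := mul_le_mul_of_nonneg_left hS1 (mul_nonneg hM0 hE0)
    _ = _ := mul_one _

/-! ## §2 Absorbing the absolute term -/

/-- ★ **ABSORPTION OF THE OFF-TUBE TERM INTO THE MAIN TERM**: with `Mfl(L) = |log cone(HubBulk ½)| + |log(coneConst³∕64)| + 183620·L⁸`, for `t ≥ 1` and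
`t^{1∕4}·(4(9L⁴+1) + Mfl(L)) ≤ X`: `(∫ρ)·e^{−X} ≤ t^{−1∕4}·((2π∕t)^α·M_ε)` (✓`exp_absorb` with `𝔐 = M_ε∕∫ρ ≥ e^{−Mfl}`). [folklore] -/
theorem bulk_absorb {ε : GnoSign L} (hε : GoodSign ε) {τ : ℝ} (hτ : 0 < τ) (hτ1 : τ ≤ 1 / 2) {t X : ℝ} (ht1 : 1 ≤ t)
    (hX : t ^ (1 / 4 : ℝ) * (4 * (9 * (L : ℝ) ^ 4 + 1) +
      (|Real.log (coneMeasure.real (HubBulk (1 / 2)))| + |Real.log (coneConst ^ 3 / 64)| + 183620 * (L : ℝ) ^ 8)) ≤ X) :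
    (∫ η : GnoCoord L, gnoDensity η) * Real.exp (-X) ≤
      t ^ (-(1 / 4 : ℝ)) * ((2 * Real.pi / t) ^ alpha L * ∫ a in HubBulk τ, (∫ p : ℝ × ℝ, mbDensity (L := L) a ε p) ∂coneMeasure) := by
  have hL1 : (1 : ℝ) ≤ L := by exact_mod_cast NeZero.one_le
  set M : ℝ := ∫ a in HubBulk τ, (∫ p : ℝ × ℝ, mbDensity (L := L) a ε p) ∂coneMeasure with hMdef
  set Mρ : ℝ := ∫ η : GnoCoord L, gnoDensity η with hMρ
  set cH : ℝ := coneMeasure.real (HubBulk (1 / 2)) with hcH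
  have hcH0 : 0 < cH := coneMeasure_hubBulk_half_pos
  have hMρ0 : 0 < Mρ := by
    have htot := gnomonic_total_mass_real (L := L) (χ := fun _ => (1 : SU2)) one_central
    have hKL0 : 0 < KL L := lt_of_lt_of_le (Real.exp_pos _) KL_floor
    have hcard : 0 < (Fintype.card (GnoSign L) : ℝ) := by exact_mod_cast Fintype.card_pos
    have hsum : ∑ _ε : GnoSign L, Mρ = (Fintype.card (GnoSign L) : ℝ) * Mρ := by rw [Finset.sum_const, Finset.card_univ, nsmul_eq_mul]
    have e : KL L * ((Fintype.card (GnoSign L) : ℝ) * Mρ) = 1 := by rw [← hsum]; unfold KL; exact htot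
    have h1 : 0 < (Fintype.card (GnoSign L) : ℝ) * Mρ := (mul_pos_iff_of_pos_left hKL0).1 (by rw [e]; exact one_pos)
    exact (mul_pos_iff_of_pos_left hcard).1 h1
  -- the floor `M/Mρ ≥ e^{−Mfl}`
  have hMfl0 : 0 ≤ |Real.log cH| + |Real.log (coneConst ^ 3 / 64)| + 183620 * (L : ℝ) ^ 8 := by positivity
  have hM_lo : cH * Real.exp (-(183602 * (L : ℝ) ^ 8)) ≤ M := bulkMass_exp_floor hε hτ hτ1
  have hMρ_hi : Mρ ≤ Real.exp (|Real.log (coneConst ^ 3 / 64)| + 18 * (L : ℝ) ^ 4) := totalMass_le_exp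
  have hfloor : Real.exp (-(|Real.log cH| + |Real.log (coneConst ^ 3 / 64)| + 183620 * (L : ℝ) ^ 8)) ≤ M / Mρ := by
    rw [le_div_iff₀ hMρ0]
    have hL8 : (L : ℝ) ^ 4 ≤ (L : ℝ) ^ 8 := pow_le_pow_right₀ hL1 (by norm_num)
    have hcH' : Real.exp (-|Real.log cH|) ≤ cH := by
      calc Real.exp (-|Real.log cH|) ≤ Real.exp (Real.log cH) := Real.exp_le_exp.2 (neg_abs_le _)
        _ = cH := Real.exp_log hcH0
    calc Real.exp (-(|Real.log cH| + |Real.log (coneConst ^ 3 / 64)| + 183620 * (L : ℝ) ^ 8)) * Mρ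
        ≤ Real.exp (-(|Real.log cH| + |Real.log (coneConst ^ 3 / 64)| + 183620 * (L : ℝ) ^ 8)) *
            Real.exp (|Real.log (coneConst ^ 3 / 64)| + 18 * (L : ℝ) ^ 4) := mul_le_mul_of_nonneg_left hMρ_hi (Real.exp_pos _).le
      _ = Real.exp (-|Real.log cH|) * Real.exp (-(183620 * (L : ℝ) ^ 8) + 18 * (L : ℝ) ^ 4) := by
          rw [← Real.exp_add, ← Real.exp_add]; congr 1; ring
      _ ≤ cH * Real.exp (-(183602 * (L : ℝ) ^ 8)) := mul_le_mul hcH' (Real.exp_le_exp.2 (by nlinarith)) (Real.exp_pos _).le hcH0.le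
      _ ≤ M := hM_lo
  -- `exp_absorb`
  have hL4 : (1 : ℝ) ≤ (L : ℝ) ^ 4 := one_le_pow₀ hL1
  have he0 : (0 : ℝ) ≤ alpha L := by rw [show alpha L = 9 * (L : ℝ) ^ 4 - 1 from by unfold alpha; exact finrank_gnoFibre_real_div_two]; linarith
  have heE : alpha L ≤ 9 * (L : ℝ) ^ 4 := by rw [show alpha L = 9 * (L : ℝ) ^ 4 - 1 from by unfold alpha; exact finrank_gnoFibre_real_div_two]; linarith
  have habs := exp_absorb (𝔐 := M / Mρ) ht1 he0 heE hMfl0 hfloor hX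
  have ht0 : 0 < t := by linarith
  calc Mρ * Real.exp (-X) ≤ Mρ * (t ^ (-(1 / 4 : ℝ)) * ((2 * Real.pi / t) ^ alpha L * (M / Mρ))) := mul_le_mul_of_nonneg_left habs hMρ0.le
    _ = t ^ (-(1 / 4 : ℝ)) * ((2 * Real.pi / t) ^ alpha L * M) := by field_simp

/-! ## §3 The two-sided log law at `t` -/

set_option maxHeartbeats 400000 in
/-- ★★ **THE TWO-SIDED LOG LAW OF THE BULK REGION AT `t`** (per good `ε`, cut `0 < τ ≤ ½`): if `t ≥ 1`, `t ≥ (K L^k τ^{−k})²` (the plane law's threshold), the absorption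
condition of §2 holds for `X = t(τ∕KL^k)^k`, and `r + x ≤ ½` with `r = K L^k τ^{−k} t^{−1∕2}`, `x = t^{−1∕4}`, then `Z_ε(t) > 0` and
`−α log t + C_ε − 2(r + x) ≤ log Z_ε(t) ≤ −α log t + C_ε + (r + x)` with `C_ε = α log 2π + log M_ε` (w2 ✓`twoSided_logLaw_of_relative`). [cite: Griffiths1964] -/
theorem bulk_logLaw {K : ℝ} (hK : 0 < K) {k : ℕ}
    (hS2 : ∀ (ψ₀ b : ℝ), 0 < ψ₀ → ψ₀ ≤ 1 → (K * (L : ℝ) ^ k * (1 / ψ₀) ^ k) ^ 2 ≤ b → ∀ a : ℍ, a ∈ HubBulk ψ₀ → ∀ ε : GnoSign L, GoodSign ε →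
      |(∫ η : GnoCoord L, Real.exp (-(b * gnoDeficit z₀ (fun _ => 1) a ε η)) * gnoDensity η) - (2 * Real.pi / b) ^ alpha L * ∫ p : ℝ × ℝ, mbDensity a ε p| ≤
        K * (L : ℝ) ^ k * (1 / ψ₀) ^ k * b ^ (-(1 / 2 : ℝ)) * ((2 * Real.pi / b) ^ alpha L * ∫ p : ℝ × ℝ, mbDensity a ε p) +
          (∫ η : GnoCoord L, gnoDensity η) * Real.exp (-(b * (ψ₀ / (K * (L : ℝ) ^ k)) ^ k)))
    {ε : GnoSign L} (hε : GoodSign ε) {τ : ℝ} (hτ : 0 < τ) (hτ1 : τ ≤ 1 / 2) {t : ℝ} (ht1 : 1 ≤ t)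
    (ht : (K * (L : ℝ) ^ k * (1 / τ) ^ k) ^ 2 ≤ t)
    (hX : t ^ (1 / 4 : ℝ) * (4 * (9 * (L : ℝ) ^ 4 + 1) +
      (|Real.log (coneMeasure.real (HubBulk (1 / 2)))| + |Real.log (coneConst ^ 3 / 64)| + 183620 * (L : ℝ) ^ 8)) ≤ t * (τ / (K * (L : ℝ) ^ k)) ^ k)
    (hρ : K * (L : ℝ) ^ k * (1 / τ) ^ k * t ^ (-(1 / 2 : ℝ)) + t ^ (-(1 / 4 : ℝ)) ≤ 1 / 2) :
    0 < ∫ a in HubBulk τ, hubIntegral a ε t ∂coneMeasure ∧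
    -(alpha L) * Real.log t + (alpha L * Real.log (2 * Real.pi) + Real.log (∫ a in HubBulk τ, (∫ p : ℝ × ℝ, mbDensity (L := L) a ε p) ∂coneMeasure)) -
        2 * (K * (L : ℝ) ^ k * (1 / τ) ^ k * t ^ (-(1 / 2 : ℝ)) + t ^ (-(1 / 4 : ℝ))) ≤ Real.log (∫ a in HubBulk τ, hubIntegral a ε t ∂coneMeasure) ∧
      Real.log (∫ a in HubBulk τ, hubIntegral a ε t ∂coneMeasure) ≤
        -(alpha L) * Real.log t + (alpha L * Real.log (2 * Real.pi) + Real.log (∫ a in HubBulk τ, (∫ p : ℝ × ℝ, mbDensity (L := L) a ε p) ∂coneMeasure)) +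
          (K * (L : ℝ) ^ k * (1 / τ) ^ k * t ^ (-(1 / 2 : ℝ)) + t ^ (-(1 / 4 : ℝ))) := by
  have ht0 : 0 < t := by linarith
  have hrel := bulk_relative_law hS2 hε hτ hτ1 ht0 ht
  have habs := bulk_absorb hε hτ hτ1 ht1 hX
  have hMpos := bulkMass_pos (L := L) hε hτ hτ1
  have hr0 : 0 ≤ K * (L : ℝ) ^ k * (1 / τ) ^ k * t ^ (-(1 / 2 : ℝ)) := by positivity
  have hx0 : 0 ≤ t ^ (-(1 / 4 : ℝ)) := Real.rpow_nonneg ht0.le _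
  exact twoSided_logLaw_of_relative ht0 hMpos hrel habs hr0 hx0 hρ

end Summit.QuantumFields.YangMills.Theorems.SwapVirialDeficit.SectorLaplace

end
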